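import Summits.CriticalPhenomena.PercolationContinuityZ3.Theorems.PercNearOneGluingNoHeavyLowerTailSunflowerUnionEdgeAnalytic
import HarnessLib

/-!
# `NoHeavyLowerTail` (crux stmt-CriticalPhenomena-4575), abstract sunflower cubic: PENDANT INVARIANCE — the analytic lemmas
# (linear two-argument merging, the link inequality, the final two-petal inequality)

Support file (seat `prim-ineq-prove-1` gen 49; `--supports stmt-CriticalPhenomena-4575`).  No `sorry`, no named facts.
Memo: run/shared/lean/prim/prim-ineq-prove-1/FINDING-PENDANT-prove1-g49.md §2.

PURPOSE.  `…SunflowerPendantBound` / `…SunflowerPendant` prove that A-safety of a graph core is preserved by attaching a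
PENDANT vertex (a new leaf `z` joined to an old vertex `v`).  Conditioning on the block `{v, z}` turns a petal `W ⊇ core` into
four sections with measures `1` (both present), `vv` (`v` present, `z` absent; core `A¹ = A|_{v=1}`, measure `β`), `u` (`v` absent,
`z` present; core `A⁰ = A|_{v=0}`, measure `b`) and `m ≤ min(u, vv)` (both absent; core `A⁰`), so that
`μ(W) = st + s(1−t)·vv + (1−s)t·u + (1−s)(1−t)·m` (`s = p_v`, `t = p_z`).  Safety of `A⁰`, `A¹` and of `A` itself (for the
`z = 0` sections, of measure `g = (1−s)m + s·vv`, core measure `a₀ = (1−s)b + sβ`) bound `∏ u_j`, `∏ vv_j`, `∏ g_j`.  In the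
normalised variables `x = u/b`, `y = g/a₀` each factor is the LINEAR function
`pfun σ τ ρ x y = σ + τx + ρy` (`σ = st`, `τ = t(1−s)b`, `ρ = (1−t)a₀`; `pfun 1 1 = μ(core of Γ + pendant)`, `pfun (1/b) (1/a₀) = 1`).
This file supplies the three elementary inequalities of the proof:
* `pfun_merge` — `ψ(x₁,y₁)ψ(x₂,y₂) ≤ ψ(1,1)·ψ(x₁x₂, y₁y₂)` for ALIGNED pairs (`(x₁−y₁)(x₂−y₂) ≥ 0`, all arguments `≥ 1`), by the
  identity `ψ(1,1)ψ(x₁x₂,y₁y₂) − ψ(x₁,y₁)ψ(x₂,y₂) = στ(x₁−1)(x₂−1) + σρ(y₁−1)(y₂−1) + τρ(x₁−y₁)(x₂−y₂)`; and its iteration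
  `prod_pfun_le_merged` over a family with `1 ≤ y_j ≤ x_j` (the other alignment follows from `pfun_swap`);
* `lfun_merge` / `prod_lfun_le` — the LINK bound `a₀·y ≤ lfun x z = (1−s)b·x + sβ·z` (`z = vv/β`) of a "g-heavy" petal survives
  merging: `lfun(x₁,z₁)·lfun(x₂,z₂) ≤ a₀·lfun(x₁x₂, z₁z₂)` when `1 ≤ x_j ≤ z_j`;
* `final_two` — the two-petal inequality `ψ(1/(bX), 1/(a₀Y))·ψ(X,Y) ≤ ψ(1,1)` for `1 ≤ X ≤ Y`, `bX ≤ 1`, `a₀Y ≤ (1−s)bX + s`: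
  `XY(ψ(1,1) − P₁P₂) = t·[st(1−s)(X−1)(1−bX)Y + s(1−t)(Y−1)(1−a₀Y)X − (1−s)(1−t)(Y−X)(a₀Y−bX)] ≥ t·s(1−s)(1−bX)(X−1)Y ≥ 0`;
* and the degenerate case `b = 0` of the pendant bound (`pendant_prod_le_zero`): when the `u_j` are pairwise orthogonal all
  factors but one are `s·(t + (1−t)vv_j)`, and the one-coin bound `∏ (t + (1−t)vv_j) ≤ (t + (1−t)β)^(n−1)`
  (`one_coin_prod_le`, = `UnionEdge.prod_gfun_le` at `s = 1`) finishes.  The main case `b > 0` is `…SunflowerPendantBound`.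
-/

noncomputable section

namespace Summit.CriticalPhenomena.PercolationContinuityZ3.Theorems.SunflowerPartition

namespace SafeCalc

open Finset

namespace Pendant

/-! ## The linear factor `ψ` and its merging -/

/-- The linear factor `ψ(x, y) = σ + τ·x + ρ·y` of the pendant computation. [this work] -/
def pfun (σ τ ρ x y : ℝ) : ℝ := σ + τ * x + ρ * y

/-- `ψ` is nonnegative on nonnegative arguments. [this work] -/
theorem pfun_nonneg {σ τ ρ x y : ℝ} (hσ : 0 ≤ σ) (hτ : 0 ≤ τ) (hρ : 0 ≤ ρ) (hx : 0 ≤ x) (hy : 0 ≤ y) :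
    0 ≤ pfun σ τ ρ x y := by
  unfold pfun; positivity

/-- `ψ` is monotone in both arguments. [this work] -/
theorem pfun_mono {σ τ ρ x y x' y' : ℝ} (hτ : 0 ≤ τ) (hρ : 0 ≤ ρ) (hx : x ≤ x') (hy : y ≤ y') :
    pfun σ τ ρ x y ≤ pfun σ τ ρ x' y' := by
  unfold pfun
  nlinarith [mul_le_mul_of_nonneg_left hx hτ, mul_le_mul_of_nonneg_left hy hρ]

/-- Exchanging the roles of the two arguments. [this work] -/
theorem pfun_swap (σ τ ρ x y : ℝ) : pfun σ τ ρ x y = pfun σ ρ τ y x := by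
  unfold pfun; ring

/-- The merging identity. [this work] -/
theorem pfun_merge_eq (σ τ ρ x₁ y₁ x₂ y₂ : ℝ) :
    pfun σ τ ρ 1 1 * pfun σ τ ρ (x₁ * x₂) (y₁ * y₂) - pfun σ τ ρ x₁ y₁ * pfun σ τ ρ x₂ y₂ =
      σ * τ * ((x₁ - 1) * (x₂ - 1)) + σ * ρ * ((y₁ - 1) * (y₂ - 1)) + τ * ρ * ((x₁ - y₁) * (x₂ - y₂)) := by
  unfold pfun; ring

/-- **2-merge inequality** for aligned pairs: `ψ(x₁,y₁)ψ(x₂,y₂) ≤ ψ(1,1)ψ(x₁x₂,y₁y₂)` when all arguments are `≥ 1` and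
`(x₁ − y₁)(x₂ − y₂) ≥ 0`. [this work] -/
theorem pfun_merge {σ τ ρ x₁ y₁ x₂ y₂ : ℝ} (hσ : 0 ≤ σ) (hτ : 0 ≤ τ) (hρ : 0 ≤ ρ) (hx₁ : 1 ≤ x₁) (hx₂ : 1 ≤ x₂)
    (hy₁ : 1 ≤ y₁) (hy₂ : 1 ≤ y₂) (hal : 0 ≤ (x₁ - y₁) * (x₂ - y₂)) :
    pfun σ τ ρ x₁ y₁ * pfun σ τ ρ x₂ y₂ ≤ pfun σ τ ρ 1 1 * pfun σ τ ρ (x₁ * x₂) (y₁ * y₂) := by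
  have h := pfun_merge_eq σ τ ρ x₁ y₁ x₂ y₂
  have e1 : 0 ≤ σ * τ * ((x₁ - 1) * (x₂ - 1)) :=
    mul_nonneg (mul_nonneg hσ hτ) (mul_nonneg (sub_nonneg.2 hx₁) (sub_nonneg.2 hx₂))
  have e2 : 0 ≤ σ * ρ * ((y₁ - 1) * (y₂ - 1)) :=
    mul_nonneg (mul_nonneg hσ hρ) (mul_nonneg (sub_nonneg.2 hy₁) (sub_nonneg.2 hy₂))
  have e3 : 0 ≤ τ * ρ * ((x₁ - y₁) * (x₂ - y₂)) := mul_nonneg (mul_nonneg hτ hρ) hal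
  linarith

/-- **Merging induction** for a nonempty family with `1 ≤ y_j ≤ x_j`:
`∏_j ψ(x_j, y_j) ≤ ψ(1,1)^(#S − 1) · ψ(∏ x_j, ∏ y_j)`. [this work] -/
theorem prod_pfun_le_merged {κ : Type*} [DecidableEq κ] {σ τ ρ : ℝ} (hσ : 0 ≤ σ) (hτ : 0 ≤ τ) (hρ : 0 ≤ ρ)
    (x y : κ → ℝ) :
    ∀ S : Finset κ, S.Nonempty → (∀ j ∈ S, 1 ≤ y j) → (∀ j ∈ S, y j ≤ x j) →
      ∏ j ∈ S, pfun σ τ ρ (x j) (y j) ≤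
        pfun σ τ ρ 1 1 ^ (S.card - 1) * pfun σ τ ρ (∏ j ∈ S, x j) (∏ j ∈ S, y j) := by
  intro S hS
  induction hS using Finset.Nonempty.cons_induction with
  | singleton i =>
    intro _ _
    simp
  | cons i S hi hS ih =>
    intro hy hyx
    rw [prod_cons, prod_cons, prod_cons, card_cons]
    have hyi : 1 ≤ y i := hy i (mem_cons_self i S)
    have hyxi : y i ≤ x i := hyx i (mem_cons_self i S)
    have hyS : ∀ j ∈ S, 1 ≤ y j := fun j hj => hy j (mem_cons_of_mem hj)
    have hyxS : ∀ j ∈ S, y j ≤ x j := fun j hj => hyx j (mem_cons_of_mem hj)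
    have hPY : 1 ≤ ∏ j ∈ S, y j := by
      have := Finset.prod_le_prod (s := S) (fun j _ => zero_le_one) hyS; simpa using this
    have hPYX : ∏ j ∈ S, y j ≤ ∏ j ∈ S, x j :=
      Finset.prod_le_prod (fun j hj => zero_le_one.trans (hyS j hj)) hyxS
    have IH := ih hyS hyxS
    have hgi : 0 ≤ pfun σ τ ρ (x i) (y i) := pfun_nonneg hσ hτ hρ (by linarith) (by linarith)
    have hc : 0 ≤ pfun σ τ ρ 1 1 := pfun_nonneg hσ hτ hρ zero_le_one zero_le_one
    have hal : 0 ≤ (x i - y i) * (∏ j ∈ S, x j - ∏ j ∈ S, y j) :=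
      mul_nonneg (sub_nonneg.2 hyxi) (sub_nonneg.2 hPYX)
    have hmerge := pfun_merge hσ hτ hρ (hyi.trans hyxi) (hPY.trans hPYX) hyi hPY hal
    have hcard : S.card + 1 - 1 = (S.card - 1) + 1 := by
      have := hS.card_pos; omega
    calc pfun σ τ ρ (x i) (y i) * ∏ j ∈ S, pfun σ τ ρ (x j) (y j)
        ≤ pfun σ τ ρ (x i) (y i) * (pfun σ τ ρ 1 1 ^ (S.card - 1) * pfun σ τ ρ (∏ j ∈ S, x j) (∏ j ∈ S, y j)) :=
          mul_le_mul_of_nonneg_left IH hgi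
      _ = pfun σ τ ρ 1 1 ^ (S.card - 1) * (pfun σ τ ρ (x i) (y i) * pfun σ τ ρ (∏ j ∈ S, x j) (∏ j ∈ S, y j)) := by
          ring
      _ ≤ pfun σ τ ρ 1 1 ^ (S.card - 1) * (pfun σ τ ρ 1 1 * pfun σ τ ρ (x i * ∏ j ∈ S, x j) (y i * ∏ j ∈ S, y j)) :=
          mul_le_mul_of_nonneg_left hmerge (pow_nonneg hc _)
      _ = pfun σ τ ρ 1 1 ^ (S.card + 1 - 1) * pfun σ τ ρ (x i * ∏ j ∈ S, x j) (y i * ∏ j ∈ S, y j) := by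
          rw [hcard, pow_succ]; ring

/-- Merging induction for the other alignment `1 ≤ x_j ≤ y_j`. [this work] -/
theorem prod_pfun_le_merged' {κ : Type*} [DecidableEq κ] {σ τ ρ : ℝ} (hσ : 0 ≤ σ) (hτ : 0 ≤ τ) (hρ : 0 ≤ ρ)
    (x y : κ → ℝ) (S : Finset κ) (hS : S.Nonempty) (hx : ∀ j ∈ S, 1 ≤ x j) (hxy : ∀ j ∈ S, x j ≤ y j) :
    ∏ j ∈ S, pfun σ τ ρ (x j) (y j) ≤
      pfun σ τ ρ 1 1 ^ (S.card - 1) * pfun σ τ ρ (∏ j ∈ S, x j) (∏ j ∈ S, y j) := by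
  have h := prod_pfun_le_merged hσ hρ hτ y x S hS hx hxy
  calc ∏ j ∈ S, pfun σ τ ρ (x j) (y j) = ∏ j ∈ S, pfun σ ρ τ (y j) (x j) :=
        prod_congr rfl fun j _ => pfun_swap σ τ ρ (x j) (y j)
    _ ≤ pfun σ ρ τ 1 1 ^ (S.card - 1) * pfun σ ρ τ (∏ j ∈ S, y j) (∏ j ∈ S, x j) := h
    _ = pfun σ τ ρ 1 1 ^ (S.card - 1) * pfun σ τ ρ (∏ j ∈ S, x j) (∏ j ∈ S, y j) := by
        rw [pfun_swap σ ρ τ 1 1, pfun_swap σ ρ τ (∏ j ∈ S, y j) (∏ j ∈ S, x j)]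

/-! ## The link function and its merging -/

/-- The link function `lfun b β s x z = (1−s)b·x + sβ·z` (`= a₀·` the upper bound for `y = g/a₀` of a g-heavy petal). [this work] -/
def lfun (b β s x z : ℝ) : ℝ := (1 - s) * b * x + s * β * z

/-- `lfun` is nonnegative on nonnegative arguments. [this work] -/
theorem lfun_nonneg {b β s x z : ℝ} (hb : 0 ≤ b) (hβ : 0 ≤ β) (hs : 0 ≤ s) (hs1 : s ≤ 1) (hx : 0 ≤ x) (hz : 0 ≤ z) :
    0 ≤ lfun b β s x z := by
  unfold lfun
  have : 0 ≤ 1 - s := by linarith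
  positivity

/-- The link-merging identity. [this work] -/
theorem lfun_merge_eq (b β s x₁ z₁ x₂ z₂ : ℝ) :
    ((1 - s) * b + s * β) * lfun b β s (x₁ * x₂) (z₁ * z₂) - lfun b β s x₁ z₁ * lfun b β s x₂ z₂ =
      (1 - s) * s * b * β * ((z₁ - x₁) * (z₂ - x₂)) := by
  unfold lfun; ring

/-- **Link merging**: `lfun(x₁,z₁)·lfun(x₂,z₂) ≤ a₀·lfun(x₁x₂, z₁z₂)` when `(z₁ − x₁)(z₂ − x₂) ≥ 0`. [this work] -/
theorem lfun_merge {b β s x₁ z₁ x₂ z₂ : ℝ} (hb : 0 ≤ b) (hβ : 0 ≤ β) (hs : 0 ≤ s) (hs1 : s ≤ 1)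
    (hal : 0 ≤ (z₁ - x₁) * (z₂ - x₂)) :
    lfun b β s x₁ z₁ * lfun b β s x₂ z₂ ≤ ((1 - s) * b + s * β) * lfun b β s (x₁ * x₂) (z₁ * z₂) := by
  have h := lfun_merge_eq b β s x₁ z₁ x₂ z₂
  have : 0 ≤ (1 - s) * s * b * β * ((z₁ - x₁) * (z₂ - x₂)) := by
    have : 0 ≤ 1 - s := by linarith
    positivity
  linarith

/-- **Link merging induction**: for a nonempty family with `1 ≤ x_j ≤ z_j`,
`∏_j lfun(x_j, z_j) ≤ a₀^(#S − 1) · lfun(∏ x_j, ∏ z_j)`, `a₀ = (1−s)b + sβ`. [this work] -/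
theorem prod_lfun_le {κ : Type*} [DecidableEq κ] {b β s : ℝ} (hb : 0 ≤ b) (hβ : 0 ≤ β) (hs : 0 ≤ s) (hs1 : s ≤ 1)
    (x z : κ → ℝ) :
    ∀ S : Finset κ, S.Nonempty → (∀ j ∈ S, 1 ≤ x j) → (∀ j ∈ S, x j ≤ z j) →
      ∏ j ∈ S, lfun b β s (x j) (z j) ≤
        ((1 - s) * b + s * β) ^ (S.card - 1) * lfun b β s (∏ j ∈ S, x j) (∏ j ∈ S, z j) := by
  intro S hS
  induction hS using Finset.Nonempty.cons_induction with
  | singleton i =>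
    intro _ _
    simp
  | cons i S hi hS ih =>
    intro hx hxz
    rw [prod_cons, prod_cons, prod_cons, card_cons]
    have hxi : 1 ≤ x i := hx i (mem_cons_self i S)
    have hxzi : x i ≤ z i := hxz i (mem_cons_self i S)
    have hxS : ∀ j ∈ S, 1 ≤ x j := fun j hj => hx j (mem_cons_of_mem hj)
    have hxzS : ∀ j ∈ S, x j ≤ z j := fun j hj => hxz j (mem_cons_of_mem hj)
    have hPX : 1 ≤ ∏ j ∈ S, x j := by
      have := Finset.prod_le_prod (s := S) (fun j _ => zero_le_one) hxS; simpa using this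
    have hPXZ : ∏ j ∈ S, x j ≤ ∏ j ∈ S, z j :=
      Finset.prod_le_prod (fun j hj => zero_le_one.trans (hxS j hj)) hxzS
    have IH := ih hxS hxzS
    have ha0 : 0 ≤ (1 - s) * b + s * β := by
      have : 0 ≤ 1 - s := by linarith
      positivity
    have hli : 0 ≤ lfun b β s (x i) (z i) := lfun_nonneg hb hβ hs hs1 (by linarith) (by linarith)
    have hal : 0 ≤ (z i - x i) * (∏ j ∈ S, z j - ∏ j ∈ S, x j) :=
      mul_nonneg (sub_nonneg.2 hxzi) (sub_nonneg.2 hPXZ)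
    have hmerge := lfun_merge hb hβ hs hs1 hal
    have hcard : S.card + 1 - 1 = (S.card - 1) + 1 := by
      have := hS.card_pos; omega
    calc lfun b β s (x i) (z i) * ∏ j ∈ S, lfun b β s (x j) (z j)
        ≤ lfun b β s (x i) (z i) * (((1 - s) * b + s * β) ^ (S.card - 1) * lfun b β s (∏ j ∈ S, x j) (∏ j ∈ S, z j)) :=
          mul_le_mul_of_nonneg_left IH hli
      _ = ((1 - s) * b + s * β) ^ (S.card - 1) * (lfun b β s (x i) (z i) * lfun b β s (∏ j ∈ S, x j) (∏ j ∈ S, z j)) := by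
          ring
      _ ≤ ((1 - s) * b + s * β) ^ (S.card - 1) *
            (((1 - s) * b + s * β) * lfun b β s (x i * ∏ j ∈ S, x j) (z i * ∏ j ∈ S, z j)) :=
          mul_le_mul_of_nonneg_left hmerge (pow_nonneg ha0 _)
      _ = ((1 - s) * b + s * β) ^ (S.card + 1 - 1) * lfun b β s (x i * ∏ j ∈ S, x j) (z i * ∏ j ∈ S, z j) := by
          rw [hcard, pow_succ]; ring

/-! ## The final two-petal inequality -/

/-- **The two-petal inequality.**  With `a₀ = (1−s)b + sβ`, `σ = st`, `τ = t(1−s)b`, `ρ = (1−t)a₀`: for `1 ≤ X ≤ Y`, `bX ≤ 1` and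
the link `a₀Y ≤ (1−s)bX + s`, `ψ(1/(bX), 1/(a₀Y))·ψ(X, Y) ≤ ψ(1, 1)`. [this work] -/
theorem final_two {b β s t X Y : ℝ} (hb : 0 < b) (hbβ : b ≤ β) (hs : 0 ≤ s) (hs1 : s ≤ 1) (ht : 0 ≤ t)
    (ht1 : t ≤ 1) (hX : 1 ≤ X) (hXY : X ≤ Y) (hbX : b * X ≤ 1)
    (hlink : ((1 - s) * b + s * β) * Y ≤ (1 - s) * b * X + s) :
    pfun (s * t) (t * (1 - s) * b) ((1 - t) * ((1 - s) * b + s * β)) (1 / (b * X)) (1 / (((1 - s) * b + s * β) * Y)) *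
      pfun (s * t) (t * (1 - s) * b) ((1 - t) * ((1 - s) * b + s * β)) X Y ≤
      pfun (s * t) (t * (1 - s) * b) ((1 - t) * ((1 - s) * b + s * β)) 1 1 := by
  set a₀ : ℝ := (1 - s) * b + s * β with ha₀
  have hs' : 0 ≤ 1 - s := by linarith
  have ht' : 0 ≤ 1 - t := by linarith
  have ha₀b : b ≤ a₀ := by rw [ha₀]; nlinarith
  have ha₀pos : 0 < a₀ := hb.trans_le ha₀b
  have hXpos : 0 < X := by linarith
  have hY : 1 ≤ Y := hX.trans hXY
  have hYpos : 0 < Y := by linarith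
  -- clear denominators
  have hP1 : pfun (s * t) (t * (1 - s) * b) ((1 - t) * a₀) (1 / (b * X)) (1 / (a₀ * Y)) =
      (s * t * (X * Y) + t * (1 - s) * Y + (1 - t) * X) / (X * Y) := by
    unfold pfun
    field_simp
  rw [hP1, div_mul_eq_mul_div, div_le_iff₀ (mul_pos hXpos hYpos)]
  -- the key identity
  have key : pfun (s * t) (t * (1 - s) * b) ((1 - t) * a₀) 1 1 * (X * Y) -
      (s * t * (X * Y) + t * (1 - s) * Y + (1 - t) * X) * pfun (s * t) (t * (1 - s) * b) ((1 - t) * a₀) X Y =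
      t * (s * t * (1 - s) * ((X - 1) * (1 - b * X) * Y) + s * (1 - t) * ((Y - 1) * (1 - a₀ * Y) * X)
        - (1 - s) * (1 - t) * ((Y - X) * (a₀ * Y - b * X))) := by
    unfold pfun; ring
  -- the two consequences of the link
  have l1 : a₀ * Y - b * X ≤ s * (1 - b * X) := by rw [ha₀]; linarith
  have l2 : (1 - s) * (1 - b * X) ≤ 1 - a₀ * Y := by rw [ha₀]; linarith
  have hbX' : 0 ≤ 1 - b * X := by linarith
  have e1 : 0 ≤ s * t * (1 - s) * ((X - 1) * (1 - b * X) * Y) := by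
    have : 0 ≤ (X - 1) * (1 - b * X) * Y := by
      have := sub_nonneg.2 hX; positivity
    positivity
  have e2 : s * (1 - t) * ((Y - 1) * ((1 - s) * (1 - b * X)) * X) ≤ s * (1 - t) * ((Y - 1) * (1 - a₀ * Y) * X) := by
    have h1 : (Y - 1) * ((1 - s) * (1 - b * X)) * X ≤ (Y - 1) * (1 - a₀ * Y) * X := by
      have := sub_nonneg.2 hY
      exact mul_le_mul_of_nonneg_right (mul_le_mul_of_nonneg_left l2 this) hXpos.le
    exact mul_le_mul_of_nonneg_left h1 (mul_nonneg hs ht')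
  have e3 : (1 - s) * (1 - t) * ((Y - X) * (a₀ * Y - b * X)) ≤ (1 - s) * (1 - t) * ((Y - X) * (s * (1 - b * X))) := by
    have h1 : (Y - X) * (a₀ * Y - b * X) ≤ (Y - X) * (s * (1 - b * X)) :=
      mul_le_mul_of_nonneg_left l1 (sub_nonneg.2 hXY)
    exact mul_le_mul_of_nonneg_left h1 (mul_nonneg hs' ht')
  have e4 : s * (1 - t) * ((Y - 1) * ((1 - s) * (1 - b * X)) * X) - (1 - s) * (1 - t) * ((Y - X) * (s * (1 - b * X))) =
      s * (1 - s) * (1 - t) * (1 - b * X) * (Y * (X - 1)) := by ring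
  have e5 : 0 ≤ s * (1 - s) * (1 - t) * (1 - b * X) * (Y * (X - 1)) := by
    have := sub_nonneg.2 hX; positivity
  nlinarith [key, e1, e2, e3, e4, e5]

/-! ## The degenerate case `b = 0` -/

/-- Nonnegative reals with pairwise products `≤ 0`: all but at most one vanish. [this work] -/
theorem exists_forall_ne_eq_zero {n : ℕ} (hn : 0 < n) (f : Fin n → ℝ) (hf0 : ∀ j, 0 ≤ f j)
    (h2 : ∀ i j, i ≠ j → f i * f j ≤ 0) : ∃ i₀, ∀ j, j ≠ i₀ → f j = 0 := by
  by_cases h : ∃ i, f i ≠ 0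
  · obtain ⟨i₀, hi₀⟩ := h
    refine ⟨i₀, fun j hj => ?_⟩
    have hle : f i₀ * f j ≤ 0 := h2 i₀ j (Ne.symm hj)
    have hge : 0 ≤ f i₀ * f j := mul_nonneg (hf0 i₀) (hf0 j)
    have hzero : f i₀ * f j = 0 := le_antisymm hle hge
    rcases mul_eq_zero.1 hzero with h0 | h0
    · exact absurd h0 hi₀
    · exact h0
  · refine ⟨⟨0, hn⟩, fun j _ => ?_⟩
    by_contra hj
    exact h ⟨j, hj⟩

/-- A product with one free factor `≤ 1` and all other factors `≤ c` is `≤ c^(n−1)`. [this work] -/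
theorem prod_le_pow_of_one_free {n : ℕ} (g : Fin n → ℝ) (i₀ : Fin n) {c : ℝ} (hg0 : ∀ j, 0 ≤ g j)
    (hgi : g i₀ ≤ 1) (hgc : ∀ j, j ≠ i₀ → g j ≤ c) : ∏ j, g j ≤ c ^ (n - 1) := by
  classical
  have hc : ∀ j ∈ univ.erase i₀, g j ≤ c := fun j hj => hgc j (Finset.mem_erase.1 hj).1
  have h1 : ∏ j ∈ univ.erase i₀, g j ≤ c ^ (n - 1) := by
    have h := Finset.prod_le_prod (s := univ.erase i₀) (fun j _ => hg0 j) hc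
    rw [prod_const, card_erase_of_mem (mem_univ i₀), card_univ, Fintype.card_fin] at h
    exact h
  have h0 : 0 ≤ ∏ j ∈ univ.erase i₀, g j := prod_nonneg fun j _ => hg0 j
  rw [← Finset.mul_prod_erase univ g (mem_univ i₀)]
  calc g i₀ * ∏ j ∈ univ.erase i₀, g j ≤ 1 * ∏ j ∈ univ.erase i₀, g j := mul_le_mul_of_nonneg_right hgi h0
    _ ≤ c ^ (n - 1) := by rw [one_mul]; exact h1

/-- One-coin bound: `∏ (t + (1−t)vv_j) ≤ (t + (1−t)β)^(n−1)` for a `β`-system (`vv_j ∈ [β,1]`, `∏ vv_j ≤ β^(n−1)`,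
pairwise `vv_i·vv_j ≤ β`); `UnionEdge.prod_gfun_le` at `s = 1` when `β > 0`. [this work] -/
theorem one_coin_prod_le {n : ℕ} {β t : ℝ} (hβ0 : 0 ≤ β) (ht : 0 ≤ t) (ht1 : t ≤ 1) (vv : Fin n → ℝ)
    (hvβ : ∀ j, β ≤ vv j) (hv1 : ∀ j, vv j ≤ 1) (hV2 : ∀ i j, i ≠ j → vv i * vv j ≤ β)
    (hpv : ∏ j, vv j ≤ β ^ (n - 1)) : ∏ j, (t + (1 - t) * vv j) ≤ (t + (1 - t) * β) ^ (n - 1) := by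
  classical
  rcases Nat.eq_zero_or_pos n with hn | hn
  · subst hn; simp
  have ht' : 0 ≤ 1 - t := sub_nonneg.2 ht1
  rcases hβ0.lt_or_eq with hβ | hβ
  · -- `β > 0`: the merging bound of `…UnionEdgeAnalytic` with `s = 1`
    have hpow : β ^ n = β * β ^ (n - 1) := by
      conv_lhs => rw [show n = (n - 1) + 1 by omega, pow_succ]
      ring
    have hU : ∀ j ∈ (univ : Finset (Fin n)), 1 ≤ vv j / β := fun j _ => by
      rw [le_div_iff₀ hβ, one_mul]; exact hvβ j
    have hpU : β * ∏ j, vv j / β ≤ 1 := by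
      rw [prod_div_distrib, prod_const, card_univ, Fintype.card_fin, hpow, mul_div_assoc', div_le_one (by positivity)]
      exact mul_le_mul_of_nonneg_left hpv hβ.le
    have key := UnionEdge.prod_gfun_le hβ zero_le_one le_rfl ht ht1 (fun j => vv j / β) (fun j => vv j / β) univ hU hU
      hpU hpU
    rw [card_univ, Fintype.card_fin] at key
    have hw : ∀ j, t + (1 - t) * vv j = UnionEdge.gfun β 1 t (vv j / β) (vv j / β) := by
      intro j; simp only [UnionEdge.gfun, min_self]; field_simp; ring
    rw [prod_congr rfl fun j _ => hw j]
    refine key.trans (le_of_eq ?_)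
    ring
  · -- `β = 0`: at most one `vv_j` is nonzero
    subst hβ
    obtain ⟨i₁, hi₁⟩ := exists_forall_ne_eq_zero hn vv hvβ (fun i j hij => hV2 i j hij)
    refine prod_le_pow_of_one_free (fun j => t + (1 - t) * vv j) i₁ (fun j => ?_) ?_ (fun j hj => ?_)
    · have := hvβ j; positivity
    · have := mul_le_mul_of_nonneg_left (hv1 i₁) ht'; linarith
    · simp [hi₁ j hj]

/-- **THE PENDANT BOUND, degenerate case `b = 0`**: the `u_j` are pairwise orthogonal, so all factors but one are
`s·(t + (1−t)vv_j)`. [this work] -/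
theorem pendant_prod_le_zero {n : ℕ} {β s t : ℝ} (hβ0 : 0 ≤ β) (hs : 0 ≤ s) (hs1 : s ≤ 1) (ht : 0 ≤ t) (ht1 : t ≤ 1)
    (u vv m : Fin n → ℝ) (hu0 : ∀ j, 0 ≤ u j) (hu1 : ∀ j, u j ≤ 1) (hvβ : ∀ j, β ≤ vv j) (hv1 : ∀ j, vv j ≤ 1)
    (hm0 : ∀ j, 0 ≤ m j) (hmu : ∀ j, m j ≤ u j) (hmv : ∀ j, m j ≤ vv j) (hU2 : ∀ i j, i ≠ j → u i * u j = 0)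
    (hV2 : ∀ i j, i ≠ j → vv i * vv j ≤ β) (hpv : ∏ j, vv j ≤ β ^ (n - 1)) :
    ∏ j, (s * t + s * (1 - t) * vv j + (1 - s) * t * u j + (1 - s) * (1 - t) * m j) ≤
      (s * t + s * (1 - t) * β) ^ (n - 1) := by
  classical
  rcases Nat.eq_zero_or_pos n with hn | hn
  · subst hn; simp
  have hs' : 0 ≤ 1 - s := sub_nonneg.2 hs1
  have ht' : 0 ≤ 1 - t := sub_nonneg.2 ht1
  obtain ⟨i₀, hi₀⟩ := exists_forall_ne_eq_zero hn u hu0 (fun i j hij => (hU2 i j hij).le)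
  set w : Fin n → ℝ := fun j => t + (1 - t) * vv j with hw
  have hw0 : ∀ j, 0 ≤ w j := fun j => by have := hβ0.trans (hvβ j); simp only [hw]; positivity
  -- pointwise bounds
  set G : Fin n → ℝ := fun j => (if j = i₀ then (1 : ℝ) else s) * w j with hG
  have hFG : ∀ j, s * t + s * (1 - t) * vv j + (1 - s) * t * u j + (1 - s) * (1 - t) * m j ≤ G j := by
    intro j
    by_cases hj : j = i₀
    · simp only [hG, hw, hj, if_true, one_mul]
      have e1 := mul_le_mul_of_nonneg_left (hu1 i₀) (mul_nonneg hs' ht)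
      have e2 := mul_le_mul_of_nonneg_left (hmv i₀) (mul_nonneg hs' ht')
      linarith
    · have hu : u j = 0 := hi₀ j hj
      have hm : m j = 0 := le_antisymm (hu ▸ hmu j) (hm0 j)
      simp only [hG, hw, hj, if_false, hu, hm, mul_zero, add_zero]
      exact le_of_eq (by ring)
  have hF0 : ∀ j, 0 ≤ s * t + s * (1 - t) * vv j + (1 - s) * t * u j + (1 - s) * (1 - t) * m j := fun j => by
    have := hβ0.trans (hvβ j); have := hu0 j; have := hm0 j; positivity
  have h1 : ∏ j, (s * t + s * (1 - t) * vv j + (1 - s) * t * u j + (1 - s) * (1 - t) * m j) ≤ ∏ j, G j :=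
    prod_le_prod (fun j _ => hF0 j) fun j _ => hFG j
  have h2 : ∏ j, G j = (∏ j, (if j = i₀ then (1 : ℝ) else s)) * ∏ j, w j := by
    simp only [hG]; rw [prod_mul_distrib]
  have h3 : ∏ j, (if j = i₀ then (1 : ℝ) else s) ≤ s ^ (n - 1) :=
    prod_le_pow_of_one_free _ i₀ (fun j => by split_ifs <;> [exact zero_le_one; exact hs]) (by simp)
      (fun j hj => by simp [hj])
  have h4 : ∏ j, w j ≤ (t + (1 - t) * β) ^ (n - 1) := one_coin_prod_le hβ0 ht ht1 vv hvβ hv1 hV2 hpv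
  have hw0' : 0 ≤ ∏ j, w j := prod_nonneg fun j _ => hw0 j
  calc ∏ j, (s * t + s * (1 - t) * vv j + (1 - s) * t * u j + (1 - s) * (1 - t) * m j)
      ≤ (∏ j, (if j = i₀ then (1 : ℝ) else s)) * ∏ j, w j := h1.trans (le_of_eq h2)
    _ ≤ s ^ (n - 1) * (t + (1 - t) * β) ^ (n - 1) :=
        mul_le_mul h3 h4 hw0' (pow_nonneg hs _)
    _ = (s * t + s * (1 - t) * β) ^ (n - 1) := by rw [← mul_pow]; ring

end Pendant

end SafeCalc

end Summit.CriticalPhenomena.PercolationContinuityZ3.Theorems.SunflowerPartition
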